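import Summits.MatrixMultiplication.OmegaCensus.STPPKernelListerDataZ61
import Summits.MatrixMultiplication.OmegaCensus.STPPKernelListerSplit


/-!
# ω-census (abelian STPP census): kernel lister rows for `ℤ₆₁` (split form), file 21 of 74 (kernel computation)

HONEST FRAMING (pub-omega census; verbatim): lottery ticket; floor = certified bounds/negative ranges.
Census STRUCTURE (seat pub-omega-stpp-2 gen 29, 2026-08-29), family (b2).  One chunk of the root computation of the kernel lister at `n = 61` in SPLIT
form (`KLister.scanFirstSel2C`, `STPPKernelListerSplit.lean`): light first blocks (part 3 of 8: 100 shapes), second blocks unrestricted.  Twin estimate ≈ 2727 calls ≈ 1 s of kernel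
(HOME `pub-omega-stpp-2-g29/code/split_plan.py`, `klister_lean.py`).  Assembled in `STPPKernelListerCapstoneZ61.lean`.  Pure finite computation; nothing here is
progress on `ω`.
-/

namespace Summit.MatrixMultiplication.OmegaCensus.KLister

/-- First blocks of this file. [folklore] -/
def sel1Z61S21P3 : List Shape := [(1, 12, 3), (1, 18, 2), (1, 36, 1), (2, 1, 18), (2, 18, 1), (3, 1, 12), (3, 12, 1), (4, 1, 9), (4, 9, 1), (6, 1, 6), (6, 6, 1), (9, 1, 4), (9, 4, 1), (12, 1, 3), (12, 3, 1), (18, 1, 2), (18, 2, 1), (36, 1, 1), (1, 1, 35), (1, 5, 7), (1, 7, 5), (1, 35, 1), (5, 1, 7), (5, 7, 1), (7, 1, 5), (7, 5, 1), (35, 1, 1), (1, 1, 34), (1, 2, 17), (1, 17, 2), (1, 34, 1), (2, 1, 17), (2, 17, 1), (17, 1, 2), (17, 2, 1), (34, 1, 1), (1, 1, 33), (1, 3, 11), (1, 11, 3), (1, 33, 1), (3, 1, 11), (3, 11, 1), (11, 1, 3), (11, 3, 1), (33, 1, 1), (1, 1, 32), (1, 2, 16), (1, 4, 8), (1, 8,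 4), (1, 16, 2), (1, 32, 1), (2, 1, 16), (2, 16, 1), (4, 1, 8), (4, 8, 1), (8, 1, 4), (8, 4, 1), (16, 1, 2), (16, 2, 1), (32, 1, 1), (1, 1, 31), (1, 31, 1), (31, 1, 1), (1, 1, 30), (1, 2, 15), (1, 3, 10), (1, 5, 6), (1, 6, 5), (1, 10, 3), (1, 15, 2), (1, 30, 1), (2, 1, 15), (2, 15, 1), (3, 1, 10), (3, 10, 1), (5, 1, 6), (5, 6, 1), (6, 1, 5), (6, 5, 1), (10, 1, 3), (10, 3, 1), (15, 1, 2), (15, 2, 1), (30, 1, 1), (1, 1, 29), (1, 29, 1), (29, 1, 1), (1, 1, 28), (1, 2, 14), (1, 4, 7), (1, 7, 4), (1, 14, 2), (1, 28, 1), (2, 1, 14), (2, 14, 1), (4, 1, 7), (4, 7, 1), (7, 1, 4), (7, 4, 1), (14, 1, 2)]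


set_option maxRecDepth 32768 in
set_option maxHeartbeats 4000000 in
/-- Rows of the kernel lister at `61` (split form) for this file's selections. [folklore] -/
theorem scanSel_Z61_S21P3 :
    scanFirstSel2C 61 deadZ61 (fun s => sel1Z61S21P3.contains s) (fun _ => true) chunksZ61 = true := by
  decide +kernel

end Summit.MatrixMultiplication.OmegaCensus.KLister
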